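import Summits.CriticalPhenomena.PercolationContinuityZ3.Theses.PercLowPointHalfSpace
import Summits.CriticalPhenomena.PercolationContinuityZ3.Theses.PercNonProliferation
import Summits.CriticalPhenomena.PercolationContinuityZ3.Theorems.PercNonProliferationSpanningBKCap
import Summits.CriticalPhenomena.PercolationContinuityZ3.Theorems.PercLowPointHalfSpaceLowPointIdentity
import Literature.Probability.Percolation.HalfSpacePinnedPairs

/-!
# Stub `stub_tallDensity` of crux `BoundaryTwoArmDecay` (stmt-CriticalPhenomena-0911), part 1: counting

Helper file for the stub `stub_tallDensity` (TALL DENSITY, line `staircase-bootstrap-floor-decoupling`) of the crux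
skeleton `Cruxes/BoundaryTwoArmDecay/Lines/staircase_bootstrap_floor_decoupling.lean` (crux
`PercLowPointHalfSpace.BoundaryTwoArmDecay`, stmt-CriticalPhenomena-0911); lands with
`--supports stmt-CriticalPhenomena-0911`.  Part 2 (`…StubTallDensity`) integrates and proves the stub.
No definitions, no notations: everything is stated in tree vocabulary.

This part is DETERMINISTIC (no measure).  With `ℍ = halfSpace 3 = {x | 0 ≤ x 0}`, the floor `L₀ = {x | x 0 = 0}`,
the floor patch `Λ_m = {x | x 0 = 0, |x 1| ≤ m, |x 2| ≤ m}` (the product finset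
`Fintype.piFinset (i ↦ if i = 0 then {0} else Icc (-m) m)`, `(2m+1)²` sites, `card_patch`) and the finite region
`R_m = ℍ ∩ B(2m)` (`(box 3 (2m)).filter (0 ≤ · 0)`), the main result `sum_weight_patch_le` reads: for a lattice
configuration `ω ⊆ E(ℤ³)` and `2m + 1 ≤ n`,

  `Σ_{x ∈ Λ_m} 1{C_ℍ(x) meets level n}(ω) · |C_ℍ(x) ∩ L₀|⁻¹ ≤ Σ_{k < |Λ_m|} 1{A □ ⋯ □ A ((k+1)-fold)}(ω)`,

`A = openCrossing R_m Λ_m ∂⁻B(2m)` the open crossing of the region from the patch to the inner vertex boundary of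
`B(2m)` (`|·| = Set.encard`, weights in `ℝ≥0∞`).  It is the instance of the abstract counting lemma
`sum_indicator_inv_le` (any vertex type): group the "tall" sites of a finite set `P` by their `H`-cluster, choosing
in each cluster the representative of least code; a cluster `V` contributes `|V ∩ P| / |V ∩ L| ≤ 1`, so the sum is
at most the number `T` of representatives, `T = Σ_{k < |P|} 1{k < T}`, and `k < T` gives `k+1` points of `P` in
pairwise distinct `H`-clusters (a fortiori not joined inside `S ⊆ H`), each joined inside `S` to `B`: the event of
`setOf_distinctClusters_subset_disjointOccurrencePow` (Grimmett 1999 §2.3, disjoint occurrence).  The crossing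
input is the first-exit decomposition `exists_exit_of_walk`: an open `ℍ`-path from `x ∈ B(2m)` to level `n > 2m`
leaves `B(2m)`, and its initial segment up to the first exit is an open path inside `ℍ ∩ B(2m)` from `x` to a site
of `∂⁻B(2m)`.
-/

noncomputable section

namespace Summit.CriticalPhenomena.PercolationContinuityZ3.Theorems.BoundaryTwoArmDecay

open MeasureTheory
open scoped ENNReal
open Literature.Probability.Percolation Literature.Probability.LatticeModels

namespace StubTallDensity

/-! ### Abstract counting -/

/-- A finite subset of `F` has at most `|F|` elements, so its cardinality times `|F|⁻¹` is at most `1`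
(`|·| = Set.encard`, read in `ℝ≥0∞`; `⊤⁻¹ = 0`). -/
theorem card_mul_inv_le_one {V : Type*} {s : Finset V} {F : Set V} (hs : (↑s : Set V) ⊆ F) :
    (s.card : ℝ≥0∞) * (((F.encard : ℕ∞) : ℝ≥0∞))⁻¹ ≤ 1 := by
  have h1 : ((s.card : ℕ∞)) ≤ F.encard := by
    rw [← Set.encard_coe_eq_coe_finsetCard]
    exact Set.encard_le_encard hs
  have h2 : (s.card : ℝ≥0∞) ≤ ((F.encard : ℕ∞) : ℝ≥0∞) := by
    rw [← ENat.toENNReal_coe]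
    exact ENat.toENNReal_le.2 h1
  rw [← div_eq_mul_inv]
  exact ENNReal.div_le_of_le_mul (by rwa [one_mul])

/-- **Abstract counting lemma.** Let `P` be a finite set of vertices of `H`, all in `L`, let `S ⊆ H`, and let
`tall x` be events transported along `H`-connections (`x ↔ r in H`, `tall x ⇒ tall r`) such that every tall
`x ∈ P` is joined inside `S` to `B`.  Then
`Σ_{x ∈ P} 1{tall x}(ω) · |{u | x ↔ u in H} ∩ L|⁻¹ ≤ Σ_{k < |P|} 1{(openCrossing S P B) □^(k+1)}(ω)`:
the left side is at most the number of `H`-clusters of tall points of `P`, and `k+1` tall points of `P` in distinct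
`H`-clusters are `k+1` points of `P` pairwise not joined inside `S`, each joined inside `S` to `B`
(`setOf_distinctClusters_subset_disjointOccurrencePow`). -/
theorem sum_indicator_inv_le {V : Type*} [Countable V] (H S L B : Set V) (P : Finset V)
    (tall : V → Set (BondConfig V)) (ω : BondConfig V)
    (hPH : ∀ x ∈ P, x ∈ H) (hPL : ∀ x ∈ P, x ∈ L) (hSH : S ⊆ H)
    (htall : ∀ x r, ω ∈ openConnIn H x r → ω ∈ tall x → ω ∈ tall r)
    (hcross : ∀ x ∈ P, ω ∈ tall x → ∃ v ∈ B, ω ∈ openConnIn S x v) :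
    ∑ x ∈ P, (tall x).indicator
        (fun ω' => (((({u | ω' ∈ openConnIn H x u} ∩ L).encard : ℕ∞) : ℝ≥0∞))⁻¹) ω ≤
      ∑ k ∈ Finset.range P.card,
        (disjointOccurrencePow (openCrossing S ↑P B) (k + 1)).indicator 1 ω := by
  classical
  obtain ⟨enc, henc⟩ := Countable.exists_injective_nat V
  set fl : V → Set V := fun x => {u | ω ∈ openConnIn H x u} ∩ L with hfl
  set w : V → ℝ≥0∞ := fun x => (tall x).indicator
    (fun ω' => (((({u | ω' ∈ openConnIn H x u} ∩ L).encard : ℕ∞) : ℝ≥0∞))⁻¹) ω with hw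
  show ∑ x ∈ P, w x ≤ _
  have hw0 : ∀ x, ω ∉ tall x → w x = 0 := fun x hx => Set.indicator_of_notMem hx _
  have hwle : ∀ x, w x ≤ ((((fl x).encard : ℕ∞) : ℝ≥0∞))⁻¹ := fun x => Set.indicator_le_self _ _ ω
  have hfleq : ∀ x r, ω ∈ openConnIn H x r → fl x = fl r := by
    intro x r h
    ext u
    simp only [hfl, Set.mem_inter_iff, Set.mem_setOf_eq]
    exact and_congr_left fun _ =>
      ⟨fun h' => LowPoint.conn_trans (LowPoint.conn_symm h) h', fun h' => LowPoint.conn_trans h h'⟩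
  -- representatives: tall points of `P` not joined (inside `H`) to a point of `P` of smaller code
  set Rep : Finset V := P.filter fun x => ω ∈ tall x ∧
      ∀ x' ∈ P, enc x' < enc x → ω ∉ openConnIn H x x' with hRep
  have hRepP : ∀ r ∈ Rep, r ∈ P := fun r hr => (Finset.mem_filter.1 hr).1
  have hRepTall : ∀ r ∈ Rep, ω ∈ tall r := fun r hr => (Finset.mem_filter.1 hr).2.1
  have hRepMin : ∀ r ∈ Rep, ∀ x' ∈ P, enc x' < enc r → ω ∉ openConnIn H r x' :=
    fun r hr => (Finset.mem_filter.1 hr).2.2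
  -- Step 1: every tall point is joined to a representative
  have h1 : ∀ x ∈ P, w x ≤ ∑ r ∈ Rep, if ω ∈ openConnIn H x r then w x else 0 := by
    intro x hx
    by_cases ht : ω ∈ tall x
    · obtain ⟨r, hrK, hrmin⟩ := Finset.exists_min_image (P.filter fun x' => ω ∈ openConnIn H x x') enc
        ⟨x, Finset.mem_filter.2 ⟨hx, LowPoint.conn_refl ω (hPH x hx)⟩⟩
      have hxr : ω ∈ openConnIn H x r := (Finset.mem_filter.1 hrK).2
      have hrRep : r ∈ Rep := by
        refine Finset.mem_filter.2 ⟨(Finset.mem_filter.1 hrK).1, htall x r hxr ht, ?_⟩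
        intro x' hx' hlt hrx'
        have : enc r ≤ enc x' := hrmin x' (Finset.mem_filter.2 ⟨hx', LowPoint.conn_trans hxr hrx'⟩)
        omega
      calc w x = if ω ∈ openConnIn H x r then w x else 0 := by rw [if_pos hxr]
        _ ≤ ∑ r ∈ Rep, if ω ∈ openConnIn H x r then w x else 0 :=
          Finset.single_le_sum (f := fun r => if ω ∈ openConnIn H x r then w x else 0)
            (fun _ _ => zero_le) hrRep
    · rw [hw0 x ht]
      exact zero_le
  -- Step 2: each representative collects at most `1`
  have h2 : ∀ r ∈ Rep, (∑ x ∈ P, if ω ∈ openConnIn H x r then w x else 0) ≤ 1 := by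
    intro r _
    have hle : ∀ x ∈ P, (if ω ∈ openConnIn H x r then w x else 0) ≤
        if ω ∈ openConnIn H x r then ((((fl r).encard : ℕ∞) : ℝ≥0∞))⁻¹ else 0 := by
      intro x _
      split_ifs with hxr
      · rw [← hfleq x r hxr]
        exact hwle x
      · exact le_rfl
    have hsub : (↑(P.filter fun x => ω ∈ openConnIn H x r) : Set V) ⊆ fl r := by
      intro x hx
      rw [Finset.coe_filter] at hx
      exact ⟨LowPoint.conn_symm hx.2, hPL x hx.1⟩
    calc (∑ x ∈ P, if ω ∈ openConnIn H x r then w x else 0)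
        ≤ ∑ x ∈ P, if ω ∈ openConnIn H x r then ((((fl r).encard : ℕ∞) : ℝ≥0∞))⁻¹ else 0 :=
          Finset.sum_le_sum hle
      _ = ((P.filter fun x => ω ∈ openConnIn H x r).card : ℝ≥0∞) * ((((fl r).encard : ℕ∞) : ℝ≥0∞))⁻¹ := by
          rw [← Finset.sum_filter, Finset.sum_const, nsmul_eq_mul]
      _ ≤ 1 := card_mul_inv_le_one hsub
  -- Step 3: `k < |Rep|` gives `k+1` representatives: points of `P` pairwise not joined inside `S`
  have hcardle : Rep.card ≤ P.card := Finset.card_filter_le _ _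
  have h3 : ∀ k, k < Rep.card → ω ∈ disjointOccurrencePow (openCrossing S ↑P B) (k + 1) := by
    intro k hk
    have hk' : k + 1 ≤ Rep.card := hk
    set f : Fin (k + 1) → {x // x ∈ Rep} := fun i => Rep.equivFin.symm (Fin.castLE hk' i) with hf
    have hfinj : Function.Injective f := Rep.equivFin.symm.injective.comp (Fin.castLE_injective hk')
    refine setOf_distinctClusters_subset_disjointOccurrencePow S ↑P B k
      ⟨fun i => (f i).1, fun i => Finset.mem_coe.2 (hRepP _ (f i).2),
        fun i => hcross _ (hRepP _ (f i).2) (hRepTall _ (f i).2), fun i j hij hconn => ?_⟩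
    have hne : (f i).1 ≠ (f j).1 := fun h => hij (hfinj (Subtype.ext h))
    have hH : ω ∈ openConnIn H (f i).1 (f j).1 := LowPoint.conn_mono hSH hconn
    rcases lt_or_gt_of_ne (henc.ne hne) with hlt | hgt
    · exact hRepMin _ (f j).2 _ (hRepP _ (f i).2) hlt (LowPoint.conn_symm hH)
    · exact hRepMin _ (f i).2 _ (hRepP _ (f j).2) hgt hH
  -- assembly
  calc ∑ x ∈ P, w x
      ≤ ∑ x ∈ P, ∑ r ∈ Rep, if ω ∈ openConnIn H x r then w x else 0 := Finset.sum_le_sum h1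
    _ = ∑ r ∈ Rep, ∑ x ∈ P, if ω ∈ openConnIn H x r then w x else 0 := Finset.sum_comm
    _ ≤ ∑ _r ∈ Rep, (1 : ℝ≥0∞) := Finset.sum_le_sum h2
    _ = (Rep.card : ℝ≥0∞) := by rw [Finset.sum_const, nsmul_eq_mul, mul_one]
    _ = ∑ k ∈ Finset.range P.card, if k < Rep.card then (1 : ℝ≥0∞) else 0 := by
        rw [Finset.sum_boole]
        have : (Finset.range P.card).filter (fun k => k < Rep.card) = Finset.range Rep.card := by
          ext k
          simp only [Finset.mem_filter, Finset.mem_range]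
          omega
        rw [this, Finset.card_range]
    _ ≤ ∑ k ∈ Finset.range P.card, (disjointOccurrencePow (openCrossing S ↑P B) (k + 1)).indicator 1 ω := by
        refine Finset.sum_le_sum fun k _ => ?_
        split_ifs with hk
        · rw [Set.indicator_of_mem (h3 k hk), Pi.one_apply]
        · exact zero_le

/-! ### The floor patch `Λ_m` -/

/-- Membership in the patch `Λ_m = {x | x 0 = 0, |x 1| ≤ m, |x 2| ≤ m}`. -/
theorem mem_patch_iff {m : ℕ} {x : Site 3} :
    x ∈ (Fintype.piFinset fun i : Fin 3 => if i = 0 then ({0} : Finset ℤ) else Finset.Icc (-(m : ℤ)) m) ↔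
      x 0 = 0 ∧ ∀ i, -(m : ℤ) ≤ x i ∧ x i ≤ m := by
  simp only [Fintype.mem_piFinset]
  constructor
  · intro h
    have h0 : x 0 = 0 := by simpa using h 0
    refine ⟨h0, fun i => ?_⟩
    by_cases hi : i = 0
    · subst hi
      rw [h0]
      omega
    · have := h i
      rw [if_neg hi, Finset.mem_Icc] at this
      exact this
  · rintro ⟨h0, h⟩ i
    by_cases hi : i = 0
    · subst hi
      simp [h0]
    · rw [if_neg hi, Finset.mem_Icc]
      exact h i

/-- `|Λ_m| = (2m+1)²`. -/
theorem card_patch (m : ℕ) :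
    (Fintype.piFinset fun i : Fin 3 => if i = 0 then ({0} : Finset ℤ) else Finset.Icc (-(m : ℤ)) m).card =
      (2 * m + 1) ^ 2 := by
  rw [Fintype.card_piFinset, Fin.prod_univ_three]
  have h1 : (1 : Fin 3) ≠ 0 := by decide
  have h2 : (2 : Fin 3) ≠ 0 := by decide
  have h3 : ((m : ℤ) + 1 - -(m : ℤ)).toNat = 2 * m + 1 := by omega
  simp only [if_true, if_neg h1, if_neg h2, Finset.card_singleton, Int.card_Icc, one_mul, h3]
  ring

/-- Patch sites lie in `B(m)`. -/
theorem mem_box_of_mem_patch {m : ℕ} {x : Site 3}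
    (hx : x ∈ (Fintype.piFinset fun i : Fin 3 => if i = 0 then ({0} : Finset ℤ) else Finset.Icc (-(m : ℤ)) m)) :
    x ∈ box 3 m :=
  mem_box.2 (mem_patch_iff.1 hx).2

/-- Patch sites lie in `B(2m)`. -/
theorem mem_box_two_mul_of_mem_patch {m : ℕ} {x : Site 3}
    (hx : x ∈ (Fintype.piFinset fun i : Fin 3 => if i = 0 then ({0} : Finset ℤ) else Finset.Icc (-(m : ℤ)) m)) :
    x ∈ box 3 (2 * m) := by
  rw [mem_box]
  intro i
  have := (mem_patch_iff.1 hx).2 i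
  push_cast
  omega

/-! ### First exit from `B(2m)` of an open `ℍ`-path -/

/-- **First-exit decomposition.** For a lattice configuration, an open walk inside `ℍ` from a site of `B(2m)` to
a site outside `B(2m)` contains an initial open segment inside `ℍ ∩ B(2m)` ending on `∂⁻B(2m)`. -/
theorem exists_exit_of_walk {ω : BondConfig (Site 3)} (hω : ω ⊆ (zdGraph 3).edgeSet) (m : ℕ)
    {a b : Site 3} (w : (openGraph ω).Walk a b) (hs : ∀ z ∈ w.support, z ∈ halfSpace 3)
    (ha : a ∈ box 3 (2 * m)) (hb : b ∉ box 3 (2 * m)) :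
    ∃ v ∈ innerBoundary (zdGraph 3) (box 3 (2 * m)),
      ω ∈ openConnIn (↑((box 3 (2 * m)).filter fun z : Site 3 => 0 ≤ z 0) : Set (Site 3)) a v := by
  induction w with
  | nil => exact (hb ha).elim
  | @cons a c b h w ih =>
    have haH : a ∈ halfSpace 3 := hs a (SimpleGraph.Walk.start_mem_support _)
    have hcs : ∀ z ∈ w.support, z ∈ halfSpace 3 := fun z hz =>
      hs z (by rw [SimpleGraph.Walk.support_cons]; exact List.mem_cons_of_mem _ hz)
    have haR : a ∈ (↑((box 3 (2 * m)).filter fun z : Site 3 => 0 ≤ z 0) : Set (Site 3)) :=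
      Finset.mem_filter.2 ⟨ha, haH⟩
    by_cases hc : c ∈ box 3 (2 * m)
    · obtain ⟨v, hv, hcv⟩ := ih hcs hc hb
      have hcR : c ∈ (↑((box 3 (2 * m)).filter fun z : Site 3 => 0 ≤ z 0) : Set (Site 3)) :=
        Finset.mem_filter.2 ⟨hc, hcs c (SimpleGraph.Walk.start_mem_support _)⟩
      have hac : ω ∈ openConnIn (↑((box 3 (2 * m)).filter fun z : Site 3 => 0 ≤ z 0) : Set (Site 3)) a c :=
        ⟨haR, hcR, SimpleGraph.Adj.reachable
          (G := (openGraph ω).induce (↑((box 3 (2 * m)).filter fun z : Site 3 => 0 ≤ z 0) : Set (Site 3)))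
          (show ((openGraph ω).induce _).Adj ⟨a, haR⟩ ⟨c, hcR⟩ from h)⟩
      exact ⟨v, hv, LowPoint.conn_trans hac hcv⟩
    · have hadj : (zdGraph 3).Adj a c := by
        have h' := (openGraph_adj ω a c).1 h
        exact (SimpleGraph.mem_edgeSet (zdGraph 3)).1 (hω h'.1)
      exact ⟨a, mem_innerBoundary_iff.2 ⟨ha, c, hc, hadj⟩, LowPoint.conn_refl ω haR⟩

/-- A site of `B(2m) ∩ ℍ` whose `ℍ`-cluster meets level `n ≥ 2m + 1` is joined inside `ℍ ∩ B(2m)` to `∂⁻B(2m)`. -/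
theorem exists_cross_of_tall {ω : BondConfig (Site 3)} (hω : ω ⊆ (zdGraph 3).edgeSet) {n m : ℕ}
    (hmn : 2 * m + 1 ≤ n) {x : Site 3} (hx : x ∈ box 3 (2 * m))
    (ht : ω ∈ {ω' : BondConfig (Site 3) | ∃ y : Site 3, (n : ℤ) ≤ y 0 ∧ ω' ∈ openConnIn (halfSpace 3) x y}) :
    ∃ v ∈ (↑(innerBoundary (zdGraph 3) (box 3 (2 * m))) : Set (Site 3)),
      ω ∈ openConnIn (↑((box 3 (2 * m)).filter fun z : Site 3 => 0 ≤ z 0) : Set (Site 3)) x v := by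
  obtain ⟨y, hy, hxy⟩ := ht
  obtain ⟨w, hw⟩ := exists_openWalk_of_mem_openConnIn hxy
  have hyb : y ∉ box 3 (2 * m) := fun h => by
    have := (mem_box.1 h 0).2
    push_cast at this
    omega
  obtain ⟨v, hv, hxv⟩ := exists_exit_of_walk hω m w hw hx hyb
  exact ⟨v, Finset.mem_coe.2 hv, hxv⟩

/-! ### The counting lemma for the patch -/

/-- **Counting lemma for the floor patch.** For a lattice configuration and `2m + 1 ≤ n`:
`Σ_{x ∈ Λ_m} 1{C_ℍ(x) meets level n}(ω) |C_ℍ(x) ∩ L₀|⁻¹ ≤ Σ_{k < |Λ_m|} 1{(openCrossing R_m Λ_m ∂⁻B(2m)) □^(k+1)}(ω)`,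
`R_m = ℍ ∩ B(2m)`. -/
theorem sum_weight_patch_le {ω : BondConfig (Site 3)} (hω : ω ⊆ (zdGraph 3).edgeSet) {n m : ℕ}
    (hmn : 2 * m + 1 ≤ n) :
    ∑ x ∈ (Fintype.piFinset fun i : Fin 3 => if i = 0 then ({0} : Finset ℤ) else Finset.Icc (-(m : ℤ)) m),
        {ω' : BondConfig (Site 3) | ∃ y : Site 3, (n : ℤ) ≤ y 0 ∧ ω' ∈ openConnIn (halfSpace 3) x y}.indicator
          (fun ω' => (((({u | ω' ∈ openConnIn (halfSpace 3) x u} ∩ {u | u 0 = 0}).encard : ℕ∞) : ℝ≥0∞))⁻¹) ω ≤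
      ∑ k ∈ Finset.range
          (Fintype.piFinset fun i : Fin 3 => if i = 0 then ({0} : Finset ℤ) else Finset.Icc (-(m : ℤ)) m).card,
        (disjointOccurrencePow
            (openCrossing (↑((box 3 (2 * m)).filter fun z : Site 3 => 0 ≤ z 0) : Set (Site 3))
              ↑(Fintype.piFinset fun i : Fin 3 => if i = 0 then ({0} : Finset ℤ) else Finset.Icc (-(m : ℤ)) m)
              ↑(innerBoundary (zdGraph 3) (box 3 (2 * m))))
            (k + 1)).indicator 1 ω := by
  refine sum_indicator_inv_le (halfSpace 3) _ {u | u 0 = 0} _ _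
    (fun x => {ω' : BondConfig (Site 3) | ∃ y : Site 3, (n : ℤ) ≤ y 0 ∧ ω' ∈ openConnIn (halfSpace 3) x y}) ω
    (fun x hx => ?_) (fun x hx => (mem_patch_iff.1 hx).1) (fun z hz => (Finset.mem_filter.1 hz).2)
    (fun x r hxr ⟨y, hy, hxy⟩ => ⟨y, hy, LowPoint.conn_trans (LowPoint.conn_symm hxr) hxy⟩)
    (fun x hx ht => exists_cross_of_tall hω hmn (mem_box_two_mul_of_mem_patch hx) ht)
  show 0 ≤ x 0
  rw [(mem_patch_iff.1 hx).1]

/-- The crossing event of the region from the patch is contained in the annulus crossing event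
`{B(m) ↔ ∂⁻B(2m) inside B(2m)}` of `SubpolynomialBlocking` (the patch lies in `B(m)`, the region in `B(2m)`). -/
theorem openCrossing_patch_subset (m : ℕ) :
    (openCrossing (↑((box 3 (2 * m)).filter fun z : Site 3 => 0 ≤ z 0) : Set (Site 3))
        ↑(Fintype.piFinset fun i : Fin 3 => if i = 0 then ({0} : Finset ℤ) else Finset.Icc (-(m : ℤ)) m)
        ↑(innerBoundary (zdGraph 3) (box 3 (2 * m))) : Set (BondConfig (Site 3))) ⊆
      {ω | ∃ x ∈ box 3 m, ∃ y ∈ innerBoundary (zdGraph 3) (box 3 (2 * m)),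
        ω ∈ openConnIn ↑(box 3 (2 * m)) x y} := by
  rintro ω ⟨x, hx, y, hy, hxy⟩
  exact ⟨x, mem_box_of_mem_patch hx, y, Finset.mem_coe.1 hy,
    LowPoint.conn_mono (fun z hz => (Finset.mem_filter.1 hz).1) hxy⟩

/-! ### Registered sub-goal -/

/-- **Registered sub-goal `stub_tallDensity_count`** (def-free): the counting lemma `sum_weight_patch_le` for the
floor patch `Λ_m` and the region `ℍ ∩ B(2m)`, verbatim. -/
theorem stub_tallDensity_count : ∀ (ω : BondConfig (Site 3)) (n m : ℕ), ω ⊆ (zdGraph 3).edgeSet → 2 * m + 1 ≤ n → ∑ x ∈ (Fintype.piFinset fun i : Fin 3 => if i = 0 then ({0} : Finset ℤ) else Finset.Icc (-(m : ℤ)) m), {ω' : BondConfig (Site 3) | ∃ y : Site 3, (n : ℤ) ≤ y 0 ∧ ω' ∈ openConnIn (halfSpace 3) x y}.indicator (fun ω' => (((({u | ω' ∈ openConnIn (halfSpace 3) x u} ∩ {u | u 0 = 0}).encard : ℕ∞) : ENNReal))⁻¹) ω ≤ ∑ k ∈ Finset.range (Fintype.piFinset fun i : Fin 3 => if i = 0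 then ({0} : Finset ℤ) else Finset.Icc (-(m : ℤ)) m).card, (disjointOccurrencePow (openCrossing (↑((box 3 (2 * m)).filter fun z : Site 3 => 0 ≤ z 0) : Set (Site 3)) ↑(Fintype.piFinset fun i : Fin 3 => if i = 0 then ({0} : Finset ℤ) else Finset.Icc (-(m : ℤ)) m) ↑(innerBoundary (zdGraph 3) (box 3 (2 * m)))) (k + 1)).indicator 1 ω :=
  fun _ _ _ hω hmn => sum_weight_patch_le hω hmn

end StubTallDensity

end Summit.CriticalPhenomena.PercolationContinuityZ3.Theorems.BoundaryTwoArmDecay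

end
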